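import Summits.CriticalPhenomena.SAWScalingLimit.Theorems.SAWLeftRightFKGFKGToTraversalBoundSlitNecklacePieces
import HarnessLib

/-!
# Window reparametrisation: loop erasure, strictly monotone traces and reversal
(crux `SAWLeftRightFKG.FKGToTraversalBound`, stmt-CriticalPhenomena-1878; line `slit-necklace`,
plumbing helpers of the registered witness stub `stub_necklaceWitnessFarU`)

The planar witness route must be a PATH, and its strictly separated index windows across a shell
(`HasSepWindows`) must survive the two reparametrisations used to produce it:

* `exists_isPath_strictMono_getVert` — LOOP ERASURE with an index map: every walk `p` contains a path
  `q` with the same endpoints and vertices among those of `p`, whose `n`-th vertex is the `ψ n`-th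
  vertex of `p` for a STRICTLY MONOTONE `ψ : ℕ → ℕ` with `ψ q.length = p.length`;
* `hasSepWindows_of_strictMono_getVert` — `k` strictly separated index windows of `q` across
  `D(y; σ₁, σ₂)` push forward along a strictly monotone trace `ψ` with
  `emb' (q.getVert n) = emb (p.getVert (ψ n))` to `k` such windows of `p` (same shell);
* `hasSepWindows_reverse` — strictly separated index windows survive reversal of the walk (read the
  windows backwards and swap the two ends of each).

Pure index bookkeeping on Mathlib's `SimpleGraph.Walk` API; no literature fact.
-/

noncomputable section

open Set SimpleGraph
open Literature.Probability.LatticeModels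

namespace Summit.CriticalPhenomena.SAWScalingLimit.Theorems.FKGToTraversalBound.SlitNecklace

/-- **Loop erasure with a strictly monotone index map.**  Every walk `p` from `u` to `v` contains a
PATH `q` from `u` to `v`, with vertices among those of `p`, together with a strictly monotone
`ψ : ℕ → ℕ` such that `q.getVert n = p.getVert (ψ n)` for `n ≤ q.length` and `ψ q.length = p.length`
(erase, edge by edge from the end, the loop closed whenever the new start vertex is revisited). [folklore] -/
theorem exists_isPath_strictMono_getVert : ∀ {V : Type*} {G : SimpleGraph V} {u v : V} (p : G.Walk u v),
    ∃ (q : G.Walk u v) (ψ : ℕ → ℕ), q.IsPath ∧ StrictMono ψ ∧ ψ q.length = p.length ∧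
      (∀ z ∈ q.support, z ∈ p.support) ∧ ∀ n, n ≤ q.length → q.getVert n = p.getVert (ψ n) := by
  intro V G u v p
  induction p with
  | nil =>
    exact ⟨Walk.nil, id, Walk.IsPath.nil, strictMono_id, rfl, fun z hz => hz, fun n _ => rfl⟩
  | @cons x x' z h p ih =>
    obtain ⟨q₁, ψ₁, hq₁, hψ₁, hlen, hsupp, hget⟩ := ih
    by_cases hx : x ∈ q₁.support
    · -- erase the loop: `x` is the `j`-th vertex of the path `q₁`; keep the suffix of `q₁` from there
      obtain ⟨j, hj, hjlen⟩ := Walk.mem_support_iff_exists_getVert.1 hx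
      subst hj
      refine ⟨q₁.drop j, fun n => ψ₁ (j + n) + 1, hq₁.drop j, fun a b hab => ?_, ?_, fun w hw => ?_,
        fun n hn => ?_⟩
      · show ψ₁ (j + a) + 1 < ψ₁ (j + b) + 1
        exact Nat.succ_lt_succ (hψ₁ (by omega))
      · simp only [Walk.drop_length, Walk.length_cons]
        rw [Nat.add_sub_of_le hjlen, hlen]
      · rw [Walk.drop_support_eq_support_drop_min] at hw
        rw [Walk.support_cons]
        exact List.mem_cons_of_mem _ (hsupp w (List.mem_of_mem_drop hw))
      · rw [Walk.drop_length] at hn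
        rw [Walk.drop_getVert, Walk.getVert_cons_succ]
        exact hget (j + n) (by omega)
    · -- `x` is a new vertex: prepend the edge and shift the index map
      obtain ⟨ψ, hψ0, hψs⟩ : ∃ ψ : ℕ → ℕ, ψ 0 = 0 ∧ ∀ m, ψ (m + 1) = ψ₁ m + 1 :=
        ⟨fun n => Nat.rec 0 (fun m _ => ψ₁ m + 1) n, rfl, fun _ => rfl⟩
      refine ⟨Walk.cons h q₁, ψ, hq₁.cons hx, strictMono_nat_of_lt_succ fun n => ?_, ?_,
        fun w hw => ?_, fun n hn => ?_⟩
      · cases n with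
        | zero => rw [hψ0, hψs]; exact Nat.succ_pos _
        | succ m => rw [hψs, hψs]; exact Nat.succ_lt_succ (hψ₁ (Nat.lt_succ_self m))
      · rw [Walk.length_cons, Walk.length_cons, hψs, hlen]
      · rw [Walk.support_cons, List.mem_cons] at hw
        rw [Walk.support_cons]
        rcases hw with rfl | hw
        · exact List.mem_cons_self
        · exact List.mem_cons_of_mem _ (hsupp w hw)
      · cases n with
        | zero => rw [hψ0]; rfl
        | succ m =>
          rw [Walk.length_cons] at hn
          rw [hψs, Walk.getVert_cons_succ, Walk.getVert_cons_succ]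
          exact hget m (by omega)

/-- **Separated windows along a strictly monotone trace.**  If `emb' (q.getVert n) = emb (p.getVert (ψ n))`
for `n ≤ q.length` with `ψ` strictly monotone and `ψ q.length ≤ p.length`, then `k` strictly
separated index windows of `q` (inside `[0, q.length]`) across `D(y; σ₁, σ₂)` push forward under
`ψ` to `k` strictly separated index windows of `p` inside `[0, p.length]` across the same shell. [folklore] -/
theorem hasSepWindows_of_strictMono_getVert : ∀ {V V' E : Type*} [PseudoMetricSpace E]
    {G : SimpleGraph V} {G' : SimpleGraph V'} {u v : V} {u' v' : V'} (emb : V → E) (emb' : V' → E)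
    (p : G.Walk u v) (q : G'.Walk u' v') (ψ : ℕ → ℕ) (k : ℕ) (y : E) (σ₁ σ₂ : ℝ),
    StrictMono ψ → ψ q.length ≤ p.length →
    (∀ n, n ≤ q.length → emb' (q.getVert n) = emb (p.getVert (ψ n))) →
    HasSepWindows emb' q k 0 q.length y σ₁ σ₂ → HasSepWindows emb p k 0 p.length y σ₁ σ₂ := by
  intro V V' E _ G G' u v u' v' emb emb' p q ψ k y σ₁ σ₂ hψ hlen hget hW
  obtain ⟨a, b, hab, hside, hsep⟩ := hW
  refine ⟨fun m => ψ (a m), fun m => ψ (b m), fun m => ?_, fun m => ?_,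
    fun m m' hmm' => hψ (hsep hmm')⟩
  · -- range: by monotonicity of `ψ` and `ψ q.length ≤ p.length`
    show 0 ≤ ψ (a m) ∧ ψ (a m) ≤ ψ (b m) ∧ ψ (b m) ≤ p.length
    exact ⟨Nat.zero_le _, hψ.monotone (hab m).2.1, (hψ.monotone (hab m).2.2).trans hlen⟩
  · -- sides: the two ends are embedded at the same points
    show (dist (emb (p.getVert (ψ (a m)))) y ≤ σ₁ ∧ σ₂ ≤ dist (emb (p.getVert (ψ (b m)))) y) ∨
      (σ₂ ≤ dist (emb (p.getVert (ψ (a m)))) y ∧ dist (emb (p.getVert (ψ (b m)))) y ≤ σ₁)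
    rw [← hget (a m) ((hab m).2.1.trans (hab m).2.2), ← hget (b m) (hab m).2.2]
    exact hside m

/-- **Separated windows of the reversed walk.**  `k` strictly separated index windows of `p` inside
`[0, p.length]` across `D(y; σ₁, σ₂)` give `k` such windows of `p.reverse`: the window `(a, b)` of
`p` becomes the window `(p.length - b, p.length - a)` of `p.reverse` (`p.reverse.getVert n =
p.getVert (p.length - n)`), with its two ends swapped and the windows enumerated backwards. [folklore] -/
theorem hasSepWindows_reverse : ∀ {V E : Type*} [PseudoMetricSpace E] {G : SimpleGraph V} {u v : V}
    (emb : V → E) (p : G.Walk u v) (k : ℕ) (y : E) (σ₁ σ₂ : ℝ),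
    HasSepWindows emb p k 0 p.length y σ₁ σ₂ →
    HasSepWindows emb p.reverse k 0 p.reverse.length y σ₁ σ₂ := by
  intro V E _ G u v emb p k y σ₁ σ₂ hW
  obtain ⟨a, b, hab, hside, hsep⟩ := hW
  refine ⟨fun m => p.length - b (Fin.rev m), fun m => p.length - a (Fin.rev m), fun m => ?_,
    fun m => ?_, fun m m' hmm' => ?_⟩
  · -- range
    show 0 ≤ p.length - b (Fin.rev m) ∧ p.length - b (Fin.rev m) ≤ p.length - a (Fin.rev m) ∧
      p.length - a (Fin.rev m) ≤ p.reverse.length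
    rw [Walk.length_reverse]
    have h := hab (Fin.rev m)
    omega
  · -- sides: the ends are swapped
    show (dist (emb (p.reverse.getVert (p.length - b (Fin.rev m)))) y ≤ σ₁ ∧
        σ₂ ≤ dist (emb (p.reverse.getVert (p.length - a (Fin.rev m)))) y) ∨
      (σ₂ ≤ dist (emb (p.reverse.getVert (p.length - b (Fin.rev m)))) y ∧
        dist (emb (p.reverse.getVert (p.length - a (Fin.rev m)))) y ≤ σ₁)
    have h := hab (Fin.rev m)
    rw [Walk.getVert_reverse, Walk.getVert_reverse, Nat.sub_sub_self h.2.2,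
      Nat.sub_sub_self (h.2.1.trans h.2.2)]
    rcases hside (Fin.rev m) with ⟨h1, h2⟩ | ⟨h1, h2⟩
    · exact Or.inr ⟨h2, h1⟩
    · exact Or.inl ⟨h2, h1⟩
  · -- strict separation, read backwards
    show p.length - a (Fin.rev m) < p.length - b (Fin.rev m')
    have hr : Fin.rev m' < Fin.rev m := Fin.rev_lt_rev.2 hmm'
    have h1 := hsep hr
    have h2 := hab (Fin.rev m)
    have h3 := hab (Fin.rev m')
    omega

end Summit.CriticalPhenomena.SAWScalingLimit.Theorems.FKGToTraversalBound.SlitNecklace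

end
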